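import Literature.MathematicalPhysics.KineticTheory.ConfinedForcedFlow
import HarnessLib

/-!
# Additive-noise SDEs, pathwise: two-sided energy bounds and increment estimates along the flow

Trunk T-KINETIC (Literature/MathematicalPhysics/KineticTheory). Model-free version of
`LangevinChainFlowBounds.lean` (same proofs), for the flow `drivenFlow Y x n` of
`ConfinedForcedFlow.lean`. The extra model input — beyond a `ConfinedDrift` — is packaged in the
hypothesis structure `RegularConfinedDrift Y`: the energy also DEcreases at most linearly along the
driven dynamics (`-K'(M)(V + c) ≤ DV(y)·Y(y + e)`; for Hamiltonian systems with friction: the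
dissipation rate is bounded by the energy), shifting a point by a small noise vector changes the
energy by at most `K_s ‖e‖ (V + c)`, and the rates are monotone in the noise size `M`. From it:

* `RegularConfinedDrift.le_energy_flow` — the LOWER Grönwall bound
  `(V(x) + c) e^{-K'(M) t} ≤ V(z(t) - n(t)) + c` (companion of `ConfinedDrift.energy_flow_le`);
* `RegularConfinedDrift.flow_sub_sub_eq_integral` — `z(t) - x - n(t) = ∫₀ᵗ Y(z)`;
* `RegularConfinedDrift.flow_local_bounds` — below an energy level `E₀`: a common radius `R₀`,
  drift bound `Y₁` and Lipschitz constant `L₁` with `‖z(t)‖ ≤ R₀`, `‖D(t)‖ ≤ t Y₁`,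
  `‖D(t) - t Y(x)‖ ≤ L₁ t (M + T Y₁)` for `D(t) = z(t) - x - n(t)` (`‖n‖ ≤ M ≤ 1` on `[0,T]`,
  `T ≤ 1`);
* `RegularConfinedDrift.flow_far` — above a level `E₁(E_K)` the flow stays strictly above the
  level `E_K` on `[0, T]` (`T ≤ 1`, small noise): a test function supported in `{V ≤ E_K}` does not
  see such trajectories.

These are the deterministic inputs of the one-step generator estimate behind Dynkin's identity
for the transition kernels of `ConfinedDriftKernel.lean`.

## References

* R. Khasminskii, *Stochastic Stability of Differential Equations* (2nd ed., 2012), §3.4, Thm 3.5.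
* L. Rey-Bellet, L. E. Thomas, Comm. Math. Phys. **225** (2002) 305–329, Lemma 3.5.
-/

noncomputable section

open MeasureTheory Filter Topology Set Metric
open scoped NNReal

namespace Literature.MathematicalPhysics.KineticTheory

open Literature.Analysis.ODE

variable {E : Type*} [NormedAddCommGroup E] [NormedSpace ℝ E]

/-! ### The hypothesis structure -/

/-- **A regular confined drift**: a confined drift (`ConfinedDrift`) whose energy also satisfies
the LOWER growth bound `-K'(M)(V(y) + c) ≤ DV(y)·Y(y + e)` for noise perturbations `‖e‖ ≤ M`, whose
value changes by at most `K_s ‖e‖ (V(y) + c)` under a noise shift `‖e‖ ≤ 1`, and whose rates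
`K, K'` are monotone. [folklore] -/
structure RegularConfinedDrift (Y : E → E) extends ConfinedDrift Y where
  /-- the rate of the lower energy bound -/
  K' : ℝ → ℝ
  /-- the constant of the noise-shift bound -/
  Kshift : ℝ
  rate_mono : Monotone K
  rate'_nonneg : ∀ M, 0 ≤ M → 0 ≤ K' M
  rate'_mono : Monotone K'
  Kshift_nonneg : 0 ≤ Kshift
  fderiv_energy_ge : ∀ (M : ℝ) (y e : E), e ∈ noise → ‖e‖ ≤ M →
    -(K' M * (V y + c)) ≤ fderiv ℝ V y (Y (y + e))
  energy_shift_le : ∀ (y e : E), e ∈ noise → ‖e‖ ≤ 1 → |V (y + e) - V y| ≤ Kshift * ‖e‖ * (V y + c)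

namespace RegularConfinedDrift

variable [FiniteDimensional ℝ E] [CompleteSpace E] {Y : E → E} (D : RegularConfinedDrift Y)
include D

/-! ### The lower energy bound -/

/-- **The energy is at most exponentially DEcreasing along the flow**: for `z = drivenFlow Y x n`
driven by a continuous noise path in the noise subspace with `‖n‖ ≤ M` on `[0, T]` and
`y = z - n` its differentiable part, `(V(x) + c) e^{-K'(M) t} ≤ V(y(t)) + c` on `[0, T]` (Grönwall
for `-(V∘y + c)`, whose derivative is `-DV(y)·Y(y + n) ≤ K'(M)(V∘y + c)`). [folklore] -/
theorem le_energy_flow (x : E) {n : ℝ → E} (hn : Continuous n) (hnS : ∀ t, n t ∈ D.noise)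
    {T M : ℝ} (hM : ∀ t ∈ Icc 0 T, ‖n t‖ ≤ M) :
    ∀ t ∈ Icc 0 T, (D.V x + D.c) * Real.exp (-D.K' M * t) ≤ D.V (drivenFlow Y x n t - n t) + D.c := by
  intro t ht
  set z := drivenFlow Y x n with hzdef
  have hT : 0 ≤ T := ht.1.trans ht.2
  have hM0 : 0 ≤ M := (norm_nonneg _).trans (hM 0 ⟨le_rfl, hT⟩)
  have hK0 : 0 ≤ D.K' M := D.rate'_nonneg M hM0
  have hYc : Continuous Y := D.contDiff_drift.continuous
  have hzc : Continuous z := D.toConfinedDrift.continuous_flow x hn hnS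
  have hz_eq : ∀ s ∈ Icc 0 T, z s = (x + n s) + ∫ r in (0 : ℝ)..s, Y (z r) :=
    D.toConfinedDrift.isIntegralSolutionOn_flow x hn hnS T
  have hVd := D.differentiable_energy
  -- `y(s) = x + ∫₀ˢ Y(z)`, `y' = Y(z)`, `y = z - n` on `[0, T]`
  set y : ℝ → E := fun s => x + ∫ r in (0 : ℝ)..s, Y (z r) with hydef
  have hy_deriv : ∀ s, HasDerivAt y (Y (z s)) s := fun s => by
    have h1 : HasDerivAt (fun u => ∫ r in (0 : ℝ)..u, Y (z r)) (Y (z s)) s :=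
      ((hYc.comp hzc).integral_hasStrictDerivAt 0 s).hasDerivAt
    exact h1.const_add x
  have hy_eq : ∀ s ∈ Icc 0 T, y s = z s - n s := fun s hs => by
    rw [hz_eq s hs]; simp only [hydef]; abel
  have hz_y : ∀ s ∈ Icc 0 T, z s = y s + n s := fun s hs => by rw [hy_eq s hs, sub_add_cancel]
  -- Grönwall for `φ = -(V∘y + c)`
  set φ : ℝ → ℝ := fun s => -(D.V (y s) + D.c) with hφdef
  have hφ_deriv : ∀ s, HasDerivAt φ (-(fderiv ℝ D.V (y s) (Y (z s)))) s := fun s =>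
    (((hVd (y s)).hasFDerivAt.comp_hasDerivAt s (hy_deriv s)).add_const D.c).neg
  have hφ_cont : Continuous φ := continuous_iff_continuousAt.2 fun s => (hφ_deriv s).continuousAt
  have hbound : ∀ s ∈ Ico 0 T, -(fderiv ℝ D.V (y s) (Y (z s))) ≤ -D.K' M * φ s + 0 := by
    intro s hs
    have h := D.fderiv_energy_ge M (y s) (n s) (hnS s) (hM s ⟨hs.1, hs.2.le⟩)
    rw [← hz_y s ⟨hs.1, hs.2.le⟩] at h
    simp only [hφdef]
    linarith
  have hG := le_gronwallBound_of_liminf_deriv_right_le (f := φ)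
    (f' := fun s => -(fderiv ℝ D.V (y s) (Y (z s)))) (δ := -(D.V x + D.c)) (K := -D.K' M) (ε := 0)
    (a := 0) (b := T) hφ_cont.continuousOn (fun s _ r hr => ?_) (by simp [hφdef, hydef]) hbound t ht
  · rw [sub_zero, gronwallBound_ε0] at hG
    have hfin : φ t = -(D.V (z t - n t) + D.c) := by
      show -(D.V (y t) + D.c) = _
      rw [hy_eq t ht]
    rw [hfin] at hG
    have : (D.V x + D.c) * Real.exp (-D.K' M * t) = -(-(D.V x + D.c) * Real.exp (-D.K' M * t)) := by ring
    linarith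
  · have := ((hφ_deriv s).hasDerivWithinAt (s := Ici s)).liminf_right_slope_le hr
    refine this.mono fun w hw => ?_
    rwa [slope_def_field, div_eq_inv_mul] at hw

/-! ### Increments of the flow -/

omit [FiniteDimensional ℝ E] [CompleteSpace E] in
/-- The a-priori radius is monotone in all of `(E₀, M, T)` (`E₀ + c ≥ 0`, `M, T ≥ 0`). [folklore] -/
theorem apriori_mono₃ {E₀ E₀' M M' T T' : ℝ} (hE : 0 ≤ E₀ + D.c) (hEE : E₀ ≤ E₀') (hM : 0 ≤ M)
    (hMM : M ≤ M') (hT : 0 ≤ T) (hTT : T ≤ T') :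
    D.apriori E₀ M T ≤ D.apriori E₀' M' T' := by
  unfold ConfinedDrift.apriori
  have hK := D.rate_nonneg M hM
  have hKK : D.K M ≤ D.K M' := D.rate_mono hMM
  refine add_le_add (D.radius_mono ?_) hMM
  have h1 : Real.exp (D.K M * T) ≤ Real.exp (D.K M' * T') :=
    Real.exp_le_exp.2 (mul_le_mul hKK hTT hT (hK.trans hKK))
  have h2 := mul_le_mul (by linarith : E₀ + D.c ≤ E₀' + D.c) h1 (Real.exp_pos _).le (by linarith)
  linarith

/-- The flow increment without the noise is the time integral of the drift:
`z(t) - x - n(t) = ∫₀ᵗ Y(z(s)) ds` on `[0, T]`. [folklore] -/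
theorem flow_sub_sub_eq_integral (x : E) {n : ℝ → E} (hn : Continuous n) (hnS : ∀ t, n t ∈ D.noise)
    {T t : ℝ} (ht : t ∈ Icc 0 T) :
    drivenFlow Y x n t - x - n t = ∫ s in (0 : ℝ)..t, Y (drivenFlow Y x n s) := by
  rw [D.toConfinedDrift.isIntegralSolutionOn_flow x hn hnS T t ht]
  beta_reduce
  abel

/-- **Local bounds for the flow started below an energy level.** For every level `E₀` with
`E₀ + c ≥ 0` there are constants `R₀, Y₁, L₁ ≥ 0` such that for every start `x` with `V(x) ≤ E₀`,
every continuous noise path in the noise subspace with `‖n‖ ≤ M ≤ 1` on `[0, T]`, `T ≤ 1`, and every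
`t ∈ [0, T]`: `‖z(t)‖ ≤ R₀`, `‖D(t)‖ ≤ t Y₁` and `‖D(t) - t Y(x)‖ ≤ L₁ t (M + T Y₁)` for the drift
increment `D(t) = z(t) - x - n(t)`. [folklore] -/
theorem flow_local_bounds {E₀ : ℝ} (hE₀ : 0 ≤ E₀ + D.c) :
    ∃ R₀ Y₁ L₁ : ℝ, 0 ≤ R₀ ∧ 0 ≤ Y₁ ∧ 0 ≤ L₁ ∧
      ∀ x : E, D.V x ≤ E₀ → ∀ {n : ℝ → E}, Continuous n → (∀ t, n t ∈ D.noise) →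
        ∀ {T M : ℝ}, (∀ t ∈ Icc 0 T, ‖n t‖ ≤ M) → M ≤ 1 → T ≤ 1 → ∀ t ∈ Icc 0 T,
          ‖drivenFlow Y x n t‖ ≤ R₀ ∧
          ‖drivenFlow Y x n t - x - n t‖ ≤ t * Y₁ ∧
          ‖drivenFlow Y x n t - x - n t - t • Y x‖ ≤ L₁ * t * (M + T * Y₁) := by
  set R₀ := max (D.apriori E₀ 1 1) 0 with hR₀
  have hYc : ContDiff ℝ 1 Y := D.contDiff_drift
  obtain ⟨Y₁', hY₁'⟩ := (isCompact_closedBall (0 : E) R₀).exists_bound_of_continuousOn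
    hYc.continuous.continuousOn
  set Y₁ := max Y₁' 0 with hY₁
  obtain ⟨L₁, hL₁⟩ := exists_lipschitzOnWith_closedBall hYc R₀
  have hρ : ∀ {x : E}, D.V x ≤ E₀ → ‖x‖ ≤ R₀ := fun {x} hx => by
    refine (D.norm_le_radius x E₀ hx).trans (le_trans ?_ (le_max_left _ _))
    unfold ConfinedDrift.apriori
    refine le_add_of_le_of_nonneg (D.radius_mono ?_) zero_le_one
    have hK := D.rate_nonneg 1 zero_le_one
    have : 1 ≤ Real.exp (D.K 1 * 1) := Real.one_le_exp (by simpa)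
    nlinarith
  have hR₀0 : 0 ≤ R₀ := le_max_right _ _
  refine ⟨R₀, Y₁, L₁, hR₀0, le_max_right _ _, L₁.2, fun x hx n hn hnS T M hM hM1 hT1 t ht => ?_⟩
  have hT : 0 ≤ T := ht.1.trans ht.2
  have hM0 : 0 ≤ M := (norm_nonneg _).trans (hM 0 ⟨le_rfl, hT⟩)
  -- the flow stays in the ball of radius `R₀`
  have hball : ∀ s ∈ Icc 0 T, ‖drivenFlow Y x n s‖ ≤ R₀ := fun s hs =>
    (D.toConfinedDrift.norm_flow_le x hn hnS hM s hs).trans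
      ((D.apriori_mono₃ (by linarith [D.energy_nonneg x]) hx hM0 hM1 hT hT1).trans (le_max_left _ _))
  have hYb : ∀ s ∈ Icc 0 T, ‖Y (drivenFlow Y x n s)‖ ≤ Y₁ := fun s hs =>
    (hY₁' _ (mem_closedBall_zero_iff.2 (hball s hs))).trans (le_max_left _ _)
  have hcont : Continuous fun s => Y (drivenFlow Y x n s) :=
    hYc.continuous.comp (D.toConfinedDrift.continuous_flow x hn hnS)
  have hDs : ∀ s ∈ Icc 0 T, ‖drivenFlow Y x n s - x - n s‖ ≤ s * Y₁ := by
    intro s hs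
    rw [D.flow_sub_sub_eq_integral x hn hnS hs]
    have h := intervalIntegral.norm_integral_le_of_norm_le_const (a := 0) (b := s) (C := Y₁)
      (f := fun r => Y (drivenFlow Y x n r)) fun r hr => ?_
    · calc ‖∫ r in (0 : ℝ)..s, Y (drivenFlow Y x n r)‖ ≤ Y₁ * |s - 0| := h
        _ = s * Y₁ := by rw [sub_zero, abs_of_nonneg hs.1, mul_comm]
    · rw [uIoc_of_le hs.1] at hr
      exact hYb r ⟨hr.1.le, hr.2.trans hs.2⟩
  refine ⟨hball t ht, hDs t ht, ?_⟩
  have hx0 : ‖x‖ ≤ R₀ := hρ hx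
  have hdiff : ∀ s ∈ Icc 0 T, ‖Y (drivenFlow Y x n s) - Y x‖ ≤ L₁ * (M + T * Y₁) := by
    intro s hs
    have h1 := hL₁.norm_sub_le (mem_closedBall_zero_iff.2 (hball s hs)) (mem_closedBall_zero_iff.2 hx0)
    refine h1.trans (mul_le_mul_of_nonneg_left ?_ L₁.2)
    calc ‖drivenFlow Y x n s - x‖ = ‖(drivenFlow Y x n s - x - n s) + n s‖ := by rw [sub_add_cancel]
      _ ≤ ‖drivenFlow Y x n s - x - n s‖ + ‖n s‖ := norm_add_le _ _
      _ ≤ s * Y₁ + M := add_le_add (hDs s hs) (hM s hs)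
      _ ≤ M + T * Y₁ := by nlinarith [hs.2, le_max_right Y₁' 0]
  have hD := D.flow_sub_sub_eq_integral x hn hnS ht
  have heq : drivenFlow Y x n t - x - n t - t • Y x =
      ∫ s in (0 : ℝ)..t, (Y (drivenFlow Y x n s) - Y x) := by
    rw [hD, intervalIntegral.integral_sub (hcont.intervalIntegrable _ _) intervalIntegrable_const,
      intervalIntegral.integral_const, sub_zero]
  rw [heq]
  have h := intervalIntegral.norm_integral_le_of_norm_le_const (a := 0) (b := t) (C := L₁ * (M + T * Y₁))
    (f := fun s => Y (drivenFlow Y x n s) - Y x) fun s hs => ?_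
  · calc ‖∫ s in (0 : ℝ)..t, (Y (drivenFlow Y x n s) - Y x)‖ ≤ L₁ * (M + T * Y₁) * |t - 0| := h
      _ = L₁ * t * (M + T * Y₁) := by rw [sub_zero, abs_of_nonneg ht.1]; ring
  · rw [uIoc_of_le ht.1] at hs
    exact hdiff s ⟨hs.1.le, hs.2.trans ht.2⟩

/-- **The far region.** For every energy level `E_K` there is a level `E₁` such that the flow
started at `V(x) > E₁` and driven by a continuous noise path in the noise subspace with
`‖n‖ ≤ M ≤ 1`, `K_s M ≤ 1/2` on `[0, T]`, `T ≤ 1`, stays STRICTLY ABOVE the level `E_K` on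
`[0, T]` (the energy decreases at most exponentially, `le_energy_flow`, and adding back the noise
costs at most `K_s M (V + c) ≤ (V + c)/2`). [folklore] -/
theorem flow_far (E_K : ℝ) :
    ∃ E₁ : ℝ, 0 ≤ E₁ + D.c ∧ ∀ x : E, E₁ < D.V x → ∀ {n : ℝ → E}, Continuous n → (∀ t, n t ∈ D.noise) →
      ∀ {T M : ℝ}, (∀ t ∈ Icc 0 T, ‖n t‖ ≤ M) → M ≤ 1 → D.Kshift * M ≤ 1 / 2 → T ≤ 1 →
        ∀ t ∈ Icc 0 T, E_K < D.V (drivenFlow Y x n t) := by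
  set A : ℝ := 2 * (|E_K + D.c| + 1) * Real.exp (D.K' 1) with hA
  set E₁ : ℝ := A - D.c with hE₁
  have hA0 : 0 ≤ A := by rw [hA]; positivity
  refine ⟨E₁, by rw [hE₁]; linarith, fun x hx n hn hnS T M hM hM1 hMs hT1 t ht => ?_⟩
  have hT : 0 ≤ T := ht.1.trans ht.2
  have hM0 : 0 ≤ M := (norm_nonneg _).trans (hM 0 ⟨le_rfl, hT⟩)
  set y := drivenFlow Y x n t - n t with hy
  have hz : drivenFlow Y x n t = y + n t := by rw [hy, sub_add_cancel]
  -- lower energy bound along the differentiable part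
  have hlow := D.le_energy_flow x hn hnS hM t ht
  have hK1 : D.K' M * t ≤ D.K' 1 := by
    calc D.K' M * t ≤ D.K' M * 1 := mul_le_mul_of_nonneg_left (ht.2.trans hT1) (D.rate'_nonneg M hM0)
      _ = D.K' M := mul_one _
      _ ≤ D.K' 1 := D.rate'_mono hM1
  have hexp : Real.exp (-D.K' 1) ≤ Real.exp (-D.K' M * t) := Real.exp_le_exp.2 (by linarith)
  have hxc : 0 ≤ D.V x + D.c := D.energy_nonneg x
  have h1 : (D.V x + D.c) * Real.exp (-D.K' 1) ≤ D.V y + D.c :=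
    (mul_le_mul_of_nonneg_left hexp hxc).trans hlow
  -- adding back the noise
  have hyc : 0 ≤ D.V y + D.c := D.energy_nonneg y
  have h2 : (D.V y + D.c) / 2 ≤ D.V (drivenFlow Y x n t) + D.c := by
    rw [hz]
    have hs := D.energy_shift_le y (n t) (hnS t) ((hM t ht).trans hM1)
    have hs' : |D.V (y + n t) - D.V y| ≤ (D.V y + D.c) / 2 := by
      refine hs.trans ?_
      have : D.Kshift * ‖n t‖ ≤ 1 / 2 :=
        (mul_le_mul_of_nonneg_left (hM t ht) D.Kshift_nonneg).trans hMs
      nlinarith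
    have := neg_abs_le (D.V (y + n t) - D.V y)
    linarith
  -- `E₁ < V(x)` and the choice of `E₁`
  have h3 : A < D.V x + D.c := by rw [hE₁] at hx; linarith
  have h4 : |E_K + D.c| + 1 < (D.V x + D.c) * Real.exp (-D.K' 1) / 2 := by
    have hmul : A * Real.exp (-D.K' 1) = 2 * (|E_K + D.c| + 1) := by
      rw [hA, mul_assoc, ← Real.exp_add, add_neg_cancel, Real.exp_zero, mul_one]
    have : A * Real.exp (-D.K' 1) < (D.V x + D.c) * Real.exp (-D.K' 1) :=
      mul_lt_mul_of_pos_right h3 (Real.exp_pos _)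
    linarith
  have hEK : E_K + D.c ≤ |E_K + D.c| := le_abs_self _
  linarith

end RegularConfinedDrift

end Literature.MathematicalPhysics.KineticTheory
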